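/-
Copyright (c) 2026. All rights reserved.
Released under Apache 2.0 license as described in the file LICENSE.
Authors: abc-iut cell, statement-typer seat abc-iut-L4-t3 (wave 1).
-/
import Mathlib.Combinatorics.Quiver.Cast
import Literature.AnabelianGeometry.AbsoluteAnabelian.DiagramMorphisms
import Literature.AnabelianGeometry.AbsoluteAnabelian.LogFrobeniusCorollaries
import HarnessLib

/-!
# [AbsTopIII] Corollary 5.5 (v): the nexus `□`, total `□`-rigidity and the `ℤ`-action on `D•`

S. Mochizuki, *Topics in absolute anabelian geometry III: global reconstruction algorithms*,
J. Math. Sci. Univ. Tokyo 22 (2015) 939–1156 [MochizukiAbsTopIII2015]; locators `p.N` = pages of the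
author's manuscript (`paper:url-5493eb38cbb7`; journal pagination not held), read on the page: Cor 5.5 (v)
pp. 131–132 (proof p. 133), (vi) p. 132; Cor 5.10 preamble pp. 146–147 (`•`-shell-containers), (iii) p. 147;
Def 3.5 (v), (vi) pp. 76–77 and §0 p. 27 for the notions used (`DiagramMorphisms.lean`, seat abc-iut-L4-t2).

Continuation of `LogFrobeniusCorollaries.lean` (Cor 5.5 (i)–(iv), Cor 5.10 (iv)(a)–(c)) over a `LogFrobeniusSetting L`
and its realised diagram of categories `L.diagram` (= `D•⊢`, whose rows 1–7 form `D•`; shape `DVertex`/`DEdge`):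
* Cor 5.5 (v): "`□` is a nexus of `Γ⃗_{D•}`" — PROVED (`DVertex.core_isNexus`; the vertices of `D⊢` lie in the
  post-nexus portion, so the statements for `D•` and `D•⊢` coincide; `core_isNexus_sub` for `D•_{≤m}`, `m ≥ 5`, e.g.
  `D• = D•_{≤7}`); "`D•` is totally `□`-rigid" = `Cor55CoreRigid`, REDUCED (`cor55CoreRigid_iff`, proved) to the
  id-rigidity of the one category `𝒳 = Th•_T[Z]`, which is what the printed proof supplies (p. 133: `Th⊚_T ≃ EA⊚` and
  slimness for `• = ⊚`, elimination of the automorphisms of the orbi-objects of a panalocal Galois-theater for `• = ✠`);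
  the `ℤ`-action: the shift `⋎ ↦ ⋎ + k` is CONSTRUCTED as a morphism of oriented graphs `DVertex.shiftGraph k` and as a
  1-morphism `L.shiftOneMorphism k` of `D•⊢` over it (identity functors at every vertex, as in the extension procedure
  of Def 3.5 (vi)); that such a 1-morphism, once an equivalence, is a nexus self-equivalence relative to `□` is PROVED
  (`shift_isNexusClass`); the assertion proper = `Cor55ShiftAction`;
* Cor 5.5 (vi) (the panalocalization morphism `D⊚ → D✠`) and Cor 5.10 (iii) are the next file,
  `LogFrobeniusPanalocalization.lean`, over the shifts constructed here.

Every `Prop` below is an ASSUMPTION on the interface datum `L` which the text asserts for the genuine Galois-theaters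
of an elliptically admissible `Z`. NOT here: the extension of the shifts to the telecore DIAGRAM `D_{An•}` of Cor 5.5
(ii) compatibly with its families `𝔍`, `ℋ_{An•}` (by identity functors again; TODO(general form)); the `TS`-valued
observable `S_log` and the second sentence of Cor 5.5 (iv) stay as recorded in `LogFrobeniusCorollaries.lean`.
Refereed pre-IUT material; nothing here bears on [IUTchIII] Cor. 3.12; typed ≠ discharged.
-/

set_option autoImplicit false

universe u

open CategoryTheory Quiver

namespace Literature.AnabelianGeometry.AbsoluteAnabelian

variable {Vmod : Type u} {isArc : Vmod → Bool}

/-! ## Corollary 5.5 (v), first clause: `□` is a nexus -/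

namespace DVertex

/-- the vertex set of the first row of `D•` — the vertices of "the infinite linear oriented graph `Γ⃗_{D•_{≤1}}`",
i.e. the pre-nexus portion `Γ⃗_{D•<□}`. [cite: MochizukiAbsTopIII2015, Cor 5.5 (v) pp. 131–132] -/
def rowOne : Set (DVertex Vmod isArc) := {x | ∃ k : ℤ, x = .row1 k}

/-- **Cor 5.5 (v), first clause** (PROVED for the realised quiver of `D•⊢`): "the unique vertex `□` of the second
row of `D•` is a nexus of `Γ⃗_{D•}`" (§0: removing `□` disconnects the first row from the rest, every edge at `□`
comes in from the first row — `id_⋎` — or goes out to a later row — `λ⊞_{v,ν}`).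
[cite: MochizukiAbsTopIII2015, Cor 5.5 (v) p. 131] -/
theorem core_isNexus : DiagramOfCategories.IsNexus (V := DVertex Vmod isArc) .core rowOne where
  not_mem := by rintro ⟨k, hk⟩; cases hk
  pre_nonempty := ⟨.row1 0, 0, rfl⟩
  post_nonempty := ⟨.e5, (fun h => by cases h), (by rintro ⟨k, hk⟩; cases hk)⟩
  no_edge_across := by
    rintro a b ⟨k, rfl⟩ hb hb'
    refine ⟨⟨fun e => ?_⟩, ⟨fun e => ?_⟩⟩
    · cases e
      · exact hb ⟨_, rfl⟩
      · exact hb' rfl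
    · cases e
      exact hb ⟨_, rfl⟩
  edge_in := by
    rintro a ⟨e⟩
    cases e
    exact ⟨_, rfl⟩
  edge_out := by
    rintro b ⟨e⟩
    cases e
    exact ⟨(by rintro ⟨k, hk⟩; cases hk), (fun h => by cases h)⟩

/-- the same for the full sub-quivers `D•_{≤m}` (`m ≥ 5`, so that the post-nexus portion is nonempty whatever
`V(F_mod)` is), in particular for `D• = D•_{≤7}` itself: `□` is a nexus of `Γ⃗_{D•_{≤m}}` with pre-nexus portion the
first row. [cite: MochizukiAbsTopIII2015, Cor 5.5 (v) p. 131] -/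
theorem core_isNexus_sub (m : ℕ) (hm : 5 ≤ m) :
    DiagramOfCategories.IsNexus (V := DSub (DVertex.InFirstRows (isArc := isArc) m))
      ⟨.core, trivial, le_trans (Nat.le_of_ble_eq_true rfl) hm⟩ {x | ∃ k : ℤ, x.1 = .row1 k} where
  not_mem := by rintro ⟨k, hk⟩; cases hk
  pre_nonempty := ⟨⟨.row1 0, trivial, le_trans (Nat.le_of_ble_eq_true rfl) hm⟩, 0, rfl⟩
  post_nonempty :=
    ⟨⟨.e5, trivial, hm⟩, (fun h => by cases congrArg Subtype.val h), (by rintro ⟨k, hk⟩; cases hk)⟩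
  no_edge_across := by
    rintro ⟨a, ha⟩ ⟨b, hb₀⟩ ⟨k, hk⟩ hb hb'
    dsimp only at hk
    subst hk
    refine ⟨⟨fun e => ?_⟩, ⟨fun e => ?_⟩⟩
    · cases e
      · exact hb ⟨_, rfl⟩
      · exact hb' rfl
    · cases e
      exact hb ⟨_, rfl⟩
  edge_in := by
    rintro ⟨a, ha⟩ ⟨e⟩
    cases e
    exact ⟨_, rfl⟩
  edge_out := by
    rintro ⟨b, hb⟩ ⟨e⟩
    cases e
    exact ⟨(by rintro ⟨k, hk⟩; cases hk), (fun h => by cases congrArg Subtype.val h)⟩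

/-! ## Corollary 5.5 (v), third clause (data): the shift of the first row as a morphism of oriented graphs -/

/-- the shift `⋎ ↦ ⋎ + k` on the arrows of `D•⊢`: `log` and `id_⋎` are carried along the first row, every other arrow
is fixed ("the identity on `Γ⃗_{D≥□}`", Def 3.5 (vi)). [cite: MochizukiAbsTopIII2015, Cor 5.5 (v) p. 132] -/
def shiftHom (k : ℤ) : {a b : DVertex Vmod isArc} → (a ⟶ b) → (a.shift k ⟶ b.shift k)
  | _, _, .log n => Quiver.Hom.cast (congrArg DVertex.row1 (Int.add_right_comm n k 1)) rfl (DEdge.log (n + k))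
  | _, _, .toCore n => .toCore (n + k)
  | _, _, .lam v ν hν => .lam v ν hν
  | _, _, .forget v => .forget v
  | _, _, .toE v => .toE v
  | _, _, .κAn => .κAn
  | _, _, .anToE => .anToE
  | _, _, .monoNplus v => .monoNplus v
  | _, _, .monoN v => .monoN v
  | _, _, .monoE5 => .monoE5
  | _, _, .monoAn => .monoAn
  | _, _, .monoE7 => .monoE7
  | _, _, .forgetMono w => .forgetMono w
  | _, _, .toEmono w => .toEmono w
  | _, _, .κAnMono => .κAnMono
  | _, _, .anMonoToE => .anMonoToE

/-- "the natural action of `ℤ` on the infinite linear oriented graph `Γ⃗_{D•_{≤1}}`", extended by the identity to a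
morphism of oriented graphs `Γ⃗_{D•⊢} → Γ⃗_{D•⊢}` (vertices: `DVertex.shift`). [cite: MochizukiAbsTopIII2015, Cor 5.5 (v) p. 132] -/
def shiftGraph (k : ℤ) : DVertex Vmod isArc ⥤q DVertex Vmod isArc where
  obj := DVertex.shift k
  map := shiftHom k

end DVertex

/-- transporting an arrow along equalities of its end-vertices does not change the functor it realises.
[cite: MochizukiAbsTopIII2015, Cor 5.5 p. 129] -/
theorem DEdge.functor_cast (L : LogFrobeniusSetting Vmod isArc) {a a' b b' : DVertex Vmod isArc} (ha : a = a')
    (hb : b = b') (e : a ⟶ b) : HEq (DEdge.functor L (e.cast ha hb)) (DEdge.functor L e) := by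
  subst ha hb; rfl

namespace LogFrobeniusSetting

variable (L : LogFrobeniusSetting Vmod isArc)

/-! ## Corollary 5.5 (v), second clause: total `□`-rigidity -/

/-- **Cor 5.5 (v), second clause** (assumption on `L`): "`D•` is totally `□`-rigid" — Def 3.5 (vi): the pre-nexus
portion `D•_{≤□}` (the copies `𝒳_⋎`, `⋎ ∈ L`, and `□`, with the arrows `log`, `id_⋎`) is totally rigid (every vertex
category id-rigid, every edge functor rigid). [cite: MochizukiAbsTopIII2015, Cor 5.5 (v) p. 131] -/
def Cor55CoreRigid : Prop :=
  L.diagram.IsTotallyNexusRigid DVertex.core DVertex.rowOne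

/-- REDUCTION of the second clause of Cor 5.5 (v) to its printed proof (p. 133): `D•` is totally `□`-rigid iff the
single category `𝒳 = Th•_T[Z]` is id-rigid (all vertices of `D•_{≤□}` carry `𝒳`; the edge functors `log ≅ id` and
`id` are then rigid; `□` is a nexus unconditionally). [cite: MochizukiAbsTopIII2015, Cor 5.5 (v) p. 133] -/
theorem cor55CoreRigid_iff : L.Cor55CoreRigid ↔ IsIdRigid L.X := by
  constructor
  · rintro ⟨-, hV, -⟩
    exact hV ⟨.core, Or.inr rfl⟩
  · intro h
    refine ⟨DVertex.core_isNexus, ?_, ?_⟩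
    · rintro ⟨a, (⟨k, rfl⟩ | ha)⟩
      · exact h
      · obtain rfl : a = .core := ha
        exact h
    · rintro ⟨a, ha⟩ ⟨b, hb⟩ e
      rcases ha with ⟨k, rfl⟩ | ha
      · cases e
        · show IsRigidFunctor L.log
          intro α
          have hβ := h (L.logIsoId.symm ≪≫ α ≪≫ L.logIsoId)
          calc α = L.logIsoId ≪≫ (L.logIsoId.symm ≪≫ α ≪≫ L.logIsoId) ≪≫ L.logIsoId.symm := by simp
            _ = Iso.refl _ := by rw [hβ]; simp
        · exact h
      · obtain rfl : a = .core := ha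
        cases e
        exact absurd hb (by rintro (⟨k, hk⟩ | hk) <;> cases hk)

/-! ## Corollary 5.5 (v), third clause: the shifts as 1-morphisms of `D•⊢`; the `ℤ`-action -/

/-- the functor of the shift at a vertex: the IDENTITY functor `𝒟_x ⥤ 𝒟_{x + k}` (the categories at `𝒳_⋎` and
`𝒳_{⋎+k}` are the same category `Th•_T[Z]`; every other vertex is fixed). [cite: MochizukiAbsTopIII2015, Cor 5.5 (v) p. 132] -/
def shiftApp (k : ℤ) : (x : DVertex Vmod isArc) → (x.category L ⥤ (x.shift k).category L)
  | .row1 _ => 𝟭 L.X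
  | .core => 𝟭 L.X
  | .nplus v => 𝟭 (L.Nplus v)
  | .nv v => 𝟭 (L.N v)
  | .e5 => 𝟭 L.E
  | .an => 𝟭 L.An
  | .e7 => 𝟭 L.E
  | .nmonoPlus w => 𝟭 (L.NmonoPlus w)
  | .nmono w => 𝟭 (L.Nmono w)
  | .emono5 => 𝟭 L.Emono
  | .anMono => 𝟭 L.AnMono
  | .emono7 => 𝟭 L.Emono

/-- the shifted `log` arrow is a transported `log` arrow. [cite: MochizukiAbsTopIII2015, Cor 5.5 (v) p. 132] -/
theorem shiftHom_log (k n : ℤ) : DVertex.shiftHom k (DEdge.log (isArc := isArc) n) =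
    Quiver.Hom.cast (congrArg DVertex.row1 (Int.add_right_comm n k 1)) rfl (DEdge.log (n + k)) := rfl

/-- the shifted `log` arrow realises `log`. [cite: MochizukiAbsTopIII2015, Cor 5.5 (v) p. 132] -/
theorem functor_shiftHom_log (k n : ℤ) :
    DEdge.functor L (DVertex.shiftHom k (DEdge.log (isArc := isArc) n)) = L.log := by
  rw [shiftHom_log]
  exact eq_of_heq (DEdge.functor_cast L _ _ _)

/-- the shift commutes (strictly) with the functors of `D•⊢`. [cite: MochizukiAbsTopIII2015, Cor 5.5 (v) p. 132] -/
theorem shift_comm (k : ℤ) {a b : DVertex Vmod isArc} (e : a ⟶ b) :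
    L.shiftApp k a ⋙ DEdge.functor L (DVertex.shiftHom k e) = DEdge.functor L e ⋙ L.shiftApp k b := by
  cases e <;> first | rfl | (rw [functor_shiftHom_log]; rfl)

/-- the shift by `k` as a 1-morphism of diagrams of categories `D•⊢ → D•⊢` (Def 3.5 (v)) over `shiftGraph k`: identity
functors at the vertices, identity (up to the strict commutation `shift_comm`) 2-cells at the arrows — the
"natural extension" of Def 3.5 (vi) of the shift of `D•_{≤□}`. [cite: MochizukiAbsTopIII2015, Cor 5.5 (v) p. 132] -/
def shiftOneMorphism (k : ℤ) :
    DiagramOfCategories.OneMorphism (DVertex.shiftGraph k) L.diagram L.diagram where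
  app := L.shiftApp k
  iso e := eqToIso (L.shift_comm k e)

/-- PROVED: a shift 1-morphism that is an equivalence of diagrams is a NEXUS self-equivalence of `D•⊢` relative to
`□` in the sense of Def 3.5 (vi) (identity on the post-nexus portion, identity functor at `□`, preserving the
pre-nexus portion). [cite: MochizukiAbsTopIII2015, Cor 5.5 (v) p. 132] -/
theorem shift_isNexusClass (k : ℤ) (h : (L.shiftOneMorphism k).IsEquivalence) :
    (⟨DVertex.shiftGraph k, L.shiftOneMorphism k, h⟩ : L.diagram.SelfEquivalence).IsNexusClass
      .core DVertex.rowOne where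
  isNexus := DVertex.core_isNexus
  maps_pre := by rintro a ⟨m, rfl⟩; exact ⟨m + k, rfl⟩
  obj_eq_of_not_mem := by
    intro a ha
    cases a <;> first | rfl | exact (ha ⟨_, rfl⟩).elim
  map_heq_of_not_mem := by
    intro a b e ha _
    cases e <;> first | exact HEq.rfl | exact (ha ⟨_, rfl⟩).elim
  app_heq_id := by
    intro a _ _
    cases a <;> exact HEq.rfl
  obj_nexus := rfl
  app_nexus_iso_id := ⟨𝟭 L.X, HEq.rfl, ⟨Iso.refl _⟩⟩

/-- a core structure of `D_{≤P} ∪ {x}` on `D_{≤P}` (as in `IsCoreOn`, Cor 5.5 (i)) whose family of homotopies EMBEDS into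
the family `K` on `D•⊢` (`CompatibleIn`). [cite: MochizukiAbsTopIII2015, Cor 5.5 (i) p. 130] -/
def IsCoreOnIn (K : L.diagram.HomotopyFamily) (P : DVertex Vmod isArc → Prop) (x : DVertex Vmod isArc) : Prop :=
  ∃ (H : ((L.subdiagram P).extend (L.obsExt P x)).HomotopyFamily)
    (hH : ∀ ⦃a b : (obsShape P x).Vertex⦄ ⦃p q : Path a b⦄, H.E p q → b = (obsShape P x).obs),
    (DiagramOfCategories.Observable.mk (obsShape P x) (fun _ => (inferInstance : IsEmpty PEmpty.{u + 1}))
      (L.obsExt P x) H hH).IsCore ∧ L.CompatibleIn K H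

/-- `K` REALISES the cores of Cor 5.5 (i) and the observables `S_log⊞` of Cor 5.5 (iii): witnessing families exist
that all embed into the one family `K` on `D•⊢` (Cor 5.5 (iii): these families "are compatible with one another as
well as with the families of homotopies that constitute the core and telecore structures of (i), (ii)").
[cite: MochizukiAbsTopIII2015, Cor 5.5 (iii) p. 131] -/
def RealisesCor55Families (K : L.diagram.HomotopyFamily) : Prop :=
  L.IsCoreOnIn K (DVertex.InFirstRows 4) .e5 ∧ L.IsCoreOnIn K (DVertex.InFirstRows 5) .an ∧
    L.IsCoreOnIn K (DVertex.InFirstRows 6) .e7 ∧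
    ∀ v : Vmod, ∃ H : (L.logDiagramPlus v).HomotopyFamily, L.IsLogObservablePlus v H ∧ L.CompatibleIn K H

/-- **Cor 5.5 (v), third clause** (assumption on `L`): "the natural action of `ℤ` on `Γ⃗_{D•_{≤1}}` extends to an
action of `ℤ` on `D•` by nexus-classes of self-equivalences of `D•`; the self-equivalences in these nexus-classes are
compatible with the families of homotopies that constitute the cores and observables of (i), (iii)" — typed for the
constructed shifts `L.shiftOneMorphism k`: (1) each is an equivalence of diagrams of categories (hence, by
`shift_isNexusClass`, a nexus self-equivalence); (2) group law: the class of the shift by `0` is that of the identity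
1-morphism and the composite of the shifts by `k` and `l` is [2-]isomorphic to the shift by `k + l` (after transport
along the equality of the underlying morphisms of graphs, as in Def 3.5 (v)); (3) each shift is compatible (Def 3.5
(v)) with one family of homotopies on `D•⊢` realising the cores of (i) and the observables of (iii). (The further
extension to the telecore diagram `D_{An•}` of (ii), compatible with `𝔍` and `ℋ_{An•}`, is by identity functors as well;
not typed as a diagram statement — TODO(general form).) [cite: MochizukiAbsTopIII2015, Cor 5.5 (v) pp. 131–132] -/
def Cor55ShiftAction : Prop :=
  (∀ k : ℤ, (L.shiftOneMorphism k).IsEquivalence) ∧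
  (∃ h₀ : DVertex.shiftGraph (Vmod := Vmod) (isArc := isArc) 0 = 𝟭q (DVertex Vmod isArc),
      (h₀ ▸ L.shiftOneMorphism 0).Isomorphic (DiagramOfCategories.OneMorphism.id L.diagram)) ∧
  (∀ k l : ℤ, ∃ h : DVertex.shiftGraph (Vmod := Vmod) (isArc := isArc) k ⋙q DVertex.shiftGraph l =
      DVertex.shiftGraph (k + l),
      (h ▸ (L.shiftOneMorphism k).comp (L.shiftOneMorphism l)).Isomorphic (L.shiftOneMorphism (k + l))) ∧
  (∃ K : L.diagram.HomotopyFamily, L.RealisesCor55Families K ∧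
      ∀ k : ℤ, Nonempty ((L.shiftOneMorphism k).CompatibleWith K K))

/-- **Cor 5.5 (v)** as one node: total `□`-rigidity and the `ℤ`-action by nexus-classes (the nexus clause being the
theorem `DVertex.core_isNexus`). [cite: MochizukiAbsTopIII2015, Cor 5.5 (v) pp. 131–132] -/
def Cor55Rigidity : Prop := L.Cor55CoreRigid ∧ L.Cor55ShiftAction

end LogFrobeniusSetting

end Literature.AnabelianGeometry.AbsoluteAnabelian
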